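import Literature.Analysis.FluidPDE.ForcedOseenRepresentationClassical
import HarnessLib

/-!
# Leray's sup-norm a-priori estimate from an `Lʳ` datum, `r > 3`, WITH A BOUNDED FORCE
# (Leray 1934, §21 (3.5), §22; Ożański–Pooley 2018, Lemma 6.23 (iii) — forced twin of
# `leray_supnorm_le_of_Lp_holds`)

Analysis/FluidPDE proof file (cell `pub/ns-blowup`, seat `ns-blowup-ecbridge-7` g4; bears_on the
E–C lane's Literature fact `lemarieRieusset2016_lerayRate_forced` (`NSForcedLerayRate.lean`), of
whose discharge this is the short-time step; theorems only, no definitions, no named facts).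
WHAT THIS IS NOT: not a statement about Navier–Stokes blow-up — a short-time pointwise bound for
GIVEN bounded classical solutions of the forced system.

**The statement** (`leray_supnorm_le_of_Lp_forced`). For `r > 3` there is `c = c(r) > 0` such that:
if `(u, p)` is a classical solution of the Navier–Stokes system on the closed slab `[0, T] × ℝ³`
(`ν > 0`) driven by a jointly continuous force `g` with bounded (`|g| ≤ G`), weakly divergence-free,
uniformly square-integrable slices, of finite energy and bounded velocity, with `‖u(0)‖_{Lʳ} ≤ N`
(`N > 0`), then for every `t ∈ (0, T]` inside the WINDOW
`t ≤ c ν^{(r+3)/(r-3)} (2N)^{-2r/(r-3)}` on which moreover the force is ABSORBED,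
`t^{1 + 3/(2r)} ν^{3/(2r)} G ≤ N`, one has `sup_x |u(t, x)| ≤ 4 N (νt)^{-3/(2r)}`.

Proof = the tree's unforced proof (`leray_supnorm_le_of_Lp_holds`, `NSLerayBlowupRateLpProofs`)
with the forced heat + Volterra inequality: the clamped sup norm `V(τ) = sup_y |u(τ ∧ T, y)|` is
measurable (lower semicontinuity of a supremum of continuous functions) and satisfies, by
`exists_norm_le_heat_add_volterra_add_force` (Ożański–Pooley (6.65) with the force's Duhamel term
`∫₀ˢ e^{ν(s-τ)Δ} P g dτ`, bounded by `s G`),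
`V(s) ≤ N(νs)^{-3/(2r)} + C₁ν^{-1/2}∫_{(0,s)}(s-τ)^{-1/2}V(τ)² dτ + sG`; on the absorbed window
`sG ≤ N(νs)^{-3/(2r)}`, so `V` satisfies the UNFORCED inequality with `N ↦ 2N`, and the tree's
comparison with the supersolution `2·(2N)(ντ)^{-3/(2r)}` (`volterra_window_bound`, Ożański–Pooley
Lemma 6.5) bounds `V(t)`. The constant is `c = (8 C₁ D)^{-2r/(r-3)}`, `D = 2(2 + 1/(1 - 3/r))`,
`C₁` the constant of the weighted Duhamel bound — the same `c` as in the unforced theorem.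

## Mathlib / tree search

Tree: `exists_norm_le_heat_add_volterra_add_force` (`ForcedOseenRepresentationClassical`),
`volterra_window_bound`, `leray_supnorm_le_of_Lp_holds` (`NSLerayBlowupRateLpProofs`, unforced),
`lowerSemicontinuous_ciSup` (Mathlib). `lean search 'supnorm_le_of_Lp_forced|heat_add_volterra_add'`:
only the seat's own files.

## References

* W. S. Ożański, B. C. Pooley, *Leray's fundamental work on the Navier–Stokes equations: a modern
  review of "Sur le mouvement d'un liquide visqueux emplissant l'espace"*, in: Partial Differential
  Equations in Fluid Mechanics, LMS Lecture Note Ser. 452, CUP (2018) = arXiv:1708.09787,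
  Lemma 6.23 (iii) with (6.65) and Lemma 6.5 (pp. 123, 143–144). [OzanskiPooley2018]
* J. Leray, *Sur le mouvement d'un liquide visqueux emplissant l'espace*, Acta Math. 63 (1934)
  193–248, §21 (3.5), (3.14)–(3.15), §22 (p. 227). [Leray1934]
-/

noncomputable section

open MeasureTheory TopologicalSpace Set Function Filter
open _root_.Topology
open scoped ENNReal NNReal

namespace Literature.Analysis.FluidPDE

/-- **Leray's sup-norm estimate from an `Lʳ` datum WITH a bounded force** (Leray 1934, §21 (3.5),
§22; Ożański–Pooley 2018, Lemma 6.23 (iii): "`‖u(t)‖_∞ ≤ C‖u₀‖_p t^{-3/2p}` for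
`t ≤ (C(1-3/p)/‖u₀‖_p)^{2p/(p-3)}`, and `p > 3`", with the force absorbed into the datum term).
For `r > 3` there is `c > 0` such that for every classical solution `(u, p)` on `[0, T] × ℝ³`
(`ν > 0`) with a jointly continuous force `g`, `|g| ≤ G`, `g(τ)` weakly divergence-free,
`sup_τ ‖g(τ)‖₂ ≤ G₂ < ∞`, finite energy, `|u| ≤ M`, and `‖u(0)‖_{Lʳ} ≤ N`, `N > 0`: for
`t ∈ (0, T]` with `t ≤ c ν^{(r+3)/(r-3)} (2N)^{-2r/(r-3)}` and `t^{1+3/(2r)} ν^{3/(2r)} G ≤ N`,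
`|u(t, x)| ≤ 4 N (νt)^{-3/(2r)}` for all `x`. [cite: OzanskiPooley2018, Lemma 6.23 (iii) with (6.65) and Lemma 6.5, pp. 143–144]
[cite: Leray1934, §21 (3.5), (3.14)–(3.15); §22 p. 227] -/
theorem leray_supnorm_le_of_Lp_forced {r : ℝ} (hr : 3 < r) :
    ∃ c : ℝ, 0 < c ∧ ∀ ⦃ν T : ℝ⦄, 0 < ν → 0 < T →
      ∀ ⦃g u : ℝ → EuclideanSpace ℝ (Fin 3) → EuclideanSpace ℝ (Fin 3)⦄
        ⦃p : ℝ → EuclideanSpace ℝ (Fin 3) → ℝ⦄ ⦃M G : ℝ⦄ ⦃G₂ : ℝ≥0∞⦄,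
        IsClassicalNSSolutionOn (Icc 0 T) ν g u p → Continuous (uncurry g) →
        (∀ τ ∈ Icc 0 T, ∀ y, ‖g τ y‖ ≤ G) → (∀ τ ∈ Icc 0 T, IsWeaklyDivFree (g τ)) → G₂ ≠ ⊤ →
        (∀ τ ∈ Icc 0 T, eLpNorm (g τ) 2 volume ≤ G₂) →
        (∃ C : ℝ≥0∞, C < ⊤ ∧ ∀ t ∈ Icc 0 T, ∫⁻ x, ‖u t x‖ₑ ^ 2 ≤ C) →
        0 < M → (∀ s ∈ Icc 0 T, ∀ y, ‖u s y‖ ≤ M) →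
        ∀ ⦃N : ℝ⦄, 0 < N → eLpNorm (u 0) (ENNReal.ofReal r) volume ≤ ENNReal.ofReal N →
        ∀ ⦃t : ℝ⦄, t ∈ Ioc 0 T →
          t ≤ c * ν ^ ((r + 3) / (r - 3)) * (2 * N) ^ (-(2 * r / (r - 3))) →
          t ^ (1 + 3 / (2 * r)) * ν ^ (3 / (2 * r)) * G ≤ N →
          ∀ x, ‖u t x‖ ≤ 4 * N * (ν * t) ^ (-(3 / (2 * r))) := by
  obtain ⟨C₁, hC₁, hA⟩ := exists_norm_le_heat_add_volterra_add_force
  have hr0 : 0 < r := by linarith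
  have hr3 : 0 < r - 3 := by linarith
  have h2β : 2 * (3 / (2 * r)) < 1 := by
    rw [show 2 * (3 / (2 * r)) = 3 / r by field_simp, div_lt_one hr0]
    linarith
  have h12β : 0 < 1 - 2 * (3 / (2 * r)) := by linarith
  have hDpos : 0 < 2 * (2 + 1 / (1 - 2 * (3 / (2 * r)))) := by positivity
  refine ⟨(8 * C₁ * (2 * (2 + 1 / (1 - 2 * (3 / (2 * r)))))) ^ (-(2 * r / (r - 3))),
    Real.rpow_pos_of_pos (by positivity) _, ?_⟩
  intro ν T hν hT g u p M G G₂ hcl hgc hG hgdiv hG₂ hg2 hE hM hMb N hN hNr t ht htw habs x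
  have hcont : ContinuousOn (uncurry u) (Icc 0 T ×ˢ univ) := hcl.smooth_velocity.continuousOn
  -- ### the clamped field and its sup norm `V`
  obtain ⟨cl, hcl_def⟩ : ∃ cl : ℝ → ℝ, cl = fun τ => max 0 (min τ T) := ⟨_, rfl⟩
  have hcl_mem : ∀ τ, cl τ ∈ Icc 0 T := fun τ => by
    rw [hcl_def]
    exact ⟨le_max_left _ _, max_le hT.le (min_le_right _ _)⟩
  have hcl_id : ∀ τ ∈ Icc 0 T, cl τ = τ := fun τ hτ => by
    rw [hcl_def]
    show max 0 (min τ T) = τ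
    rw [min_eq_left hτ.2, max_eq_right hτ.1]
  have hcl_cont : Continuous cl := by
    rw [hcl_def]
    exact continuous_const.max (continuous_id.min continuous_const)
  obtain ⟨V, hV⟩ : ∃ V : ℝ → ℝ, V = fun τ => ⨆ y, ‖u (cl τ) y‖ := ⟨_, rfl⟩
  have hbddV : ∀ τ, BddAbove (range fun y => ‖u (cl τ) y‖) := fun τ =>
    ⟨M, forall_mem_range.2 fun y => hMb _ (hcl_mem τ) y⟩
  have hVle : ∀ τ y, ‖u (cl τ) y‖ ≤ V τ := fun τ y => by
    rw [hV]
    exact le_ciSup (hbddV τ) y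
  have hV0 : ∀ τ, 0 ≤ V τ := fun τ => (norm_nonneg _).trans (hVle τ 0)
  have hVM : ∀ τ, V τ ≤ M := fun τ => by
    rw [hV]
    exact ciSup_le fun y => hMb _ (hcl_mem τ) y
  have hVu : ∀ τ ∈ Icc 0 T, ∀ y, ‖u τ y‖ ≤ V τ := fun τ hτ y => by
    have h := hVle τ y
    rwa [hcl_id τ hτ] at h
  have hVm : Measurable V := by
    have hcy : ∀ y : EuclideanSpace ℝ (Fin 3), Continuous fun τ : ℝ => ‖u (cl τ) y‖ := fun y => by
      have h1 : Continuous fun τ : ℝ => (cl τ, y) := hcl_cont.prodMk continuous_const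
      exact (hcont.comp_continuous h1 fun τ => ⟨hcl_mem τ, mem_univ _⟩).norm
    rw [hV]
    exact (lowerSemicontinuous_ciSup
      (f := fun (y : EuclideanSpace ℝ (Fin 3)) (τ : ℝ) => ‖u (cl τ) y‖) hbddV
      fun y => (hcy y).lowerSemicontinuous).measurable
  -- ### the forced inequality (6.65) for `V` on `(0, t]`, force absorbed: `N ↦ 2N`
  have hVolt : ∀ s ∈ Ioc 0 t, V s ≤ 2 * N * (ν * s) ^ (-(3 / (2 * r))) +
      C₁ * ν ^ (-(1 / 2 : ℝ)) * ∫ τ in Ioo 0 s, (s - τ) ^ (-(1 / 2 : ℝ)) * V τ ^ 2 := by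
    intro s hs
    have hsT : s ∈ Ioc 0 T := ⟨hs.1, hs.2.trans ht.2⟩
    have hsup := hA hν hT (by linarith : (1 : ℝ) ≤ r) hN.le hcl hgc hG hgdiv hG₂ hg2 hE hM hMb hVm
      hV0 hVM hVu hNr s hsT
    -- the force term: `s G ≤ N (ν s)^{-3/(2r)}` on `(0, t]`
    have hνs : 0 < ν * s := mul_pos hν hs.1
    have hsG : s * G ≤ N * (ν * s) ^ (-(3 / (2 * r))) := by
      have hG0 : 0 ≤ G := (norm_nonneg _).trans (hG 0 ⟨le_rfl, hT.le⟩ 0)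
      have h1 : s ^ (1 + 3 / (2 * r)) * ν ^ (3 / (2 * r)) * G ≤ N := by
        refine le_trans ?_ habs
        have : s ^ (1 + 3 / (2 * r)) ≤ t ^ (1 + 3 / (2 * r)) :=
          Real.rpow_le_rpow hs.1.le hs.2 (by positivity)
        exact mul_le_mul_of_nonneg_right (mul_le_mul_of_nonneg_right this
          (Real.rpow_nonneg hν.le _)) hG0
      -- divide by `(ν s)^{3/(2r)} = ν^{3/(2r)} s^{3/(2r)}`
      have hsβ : s ^ (3 / (2 * r)) ≠ 0 := (Real.rpow_pos_of_pos hs.1 _).ne'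
      have hνβ : ν ^ (3 / (2 * r)) ≠ 0 := (Real.rpow_pos_of_pos hν _).ne'
      have hpow : (ν * s) ^ (-(3 / (2 * r))) * (s ^ (1 + 3 / (2 * r)) * ν ^ (3 / (2 * r))) = s := by
        rw [Real.rpow_neg hνs.le, Real.mul_rpow hν.le hs.1.le,
          Real.rpow_add hs.1, Real.rpow_one]
        field_simp
      calc s * G = (ν * s) ^ (-(3 / (2 * r))) * (s ^ (1 + 3 / (2 * r)) * ν ^ (3 / (2 * r)) * G) := by
            rw [← mul_assoc, hpow]
        _ ≤ (ν * s) ^ (-(3 / (2 * r))) * N :=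
            mul_le_mul_of_nonneg_left h1 (Real.rpow_nonneg hνs.le _)
        _ = N * (ν * s) ^ (-(3 / (2 * r))) := mul_comm _ _
    have hVs : V s = ⨆ y, ‖u s y‖ := by
      rw [hV]
      show (⨆ y, ‖u (cl s) y‖) = ⨆ y, ‖u s y‖
      rw [hcl_id s ⟨hs.1.le, hsT.2⟩]
    rw [hVs]
    refine ciSup_le fun y => (hsup y).trans ?_
    linarith
  -- ### the comparison on the window, and the conclusion
  have h2N : 0 < 2 * N := by positivity
  have hwin := volterra_window_bound hC₁ hν h2N hM hr ht.1 hVm hV0 hVM hVolt htw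
  calc ‖u t x‖ ≤ V t := hVu t ⟨ht.1.le, ht.2⟩ x
    _ ≤ 2 * (2 * N) * (ν * t) ^ (-(3 / (2 * r))) := hwin
    _ = 4 * N * (ν * t) ^ (-(3 / (2 * r))) := by ring

end Literature.Analysis.FluidPDE

end
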